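import Summits.AtomisticToContinuum.HydrodynamicLimit.Theorems.CollisionIsometryCLTDiffuseBackwardInfluenceConditionalPair
import Summits.AtomisticToContinuum.HydrodynamicLimit.Theorems.CollisionIsometryCLTDiffuseBackwardInfluencePairMeasurableD
import HarnessLib

/-! Glue certificate, VARIANT B (self-contained check copy that elaborates while the farm has not yet BUILT the landed module
`…PairBound` (p144187): `stub_pairPathBoundT` enters `DiffuseBackwardInfluence_of_subs` as a HYPOTHESIS with its landed signature verbatim;
everything else identical with SplitGlue.lean): bridges between the inline children and the Theorems-side conjecture decls,
and the split glue `DiffuseBackwardInfluence_of_subs` from the LANDED v8 stubs. The landable tree version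
(`CollisionIsometryCLTDiffuseBackwardInfluenceSplit.lean`) is this file with the `SplitScratch` copies replaced by the route decls. -/

namespace Summit.AtomisticToContinuum.HydrodynamicLimit.Theses.CollisionIsometryCLT.SplitScratch

open scoped BigOperators Topology Manifold Classical MeasureTheory ProbabilityTheory Matrix InnerProductSpace ComplexConjugate ContinuousMap
open Filter Set Function TopologicalSpace MeasureTheory

/-- child TracerNearSetLD (scratch copy, text-identical with the route item to be filed). -/
def TracerNearSetLD : Prop :=
  ∃ σ₀ : ℝ, 0 < σ₀ ∧ ∀ σ : ℝ, 0 < σ → σ < σ₀ → ∀ θ : ℝ, 0 < θ → ∃ K : ℝ, 0 < K ∧ ∀ δ α : ℝ, 0 < δ → 0 < α → α < 1 → ∀ Δ : ℕ → ℝ, (∀ N, 0 < Δ N) → Tendsto Δ atTop (𝓝 0) → Tendsto (fun N : ℕ => Δ N * ((N + 1 : ℕ) : ℝ) ^ ((1 : ℝ) / 3)) atTop atTop → ∀ S r : ℕ, 1 ≤ S → r < S → ∀ᶠ N : ℕ in atTop, ∀ (Φ : Literature.Analysis.FluidPDE.HardSphereFlow (Literature.Analysis.FluidPDE.Torus.geometry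 (Fin 3)) (Literature.MathematicalPhysics.KineticTheory.hsDiameter σ N) (N + 1)) (A : Finset (Fin (N + 1))), δ * ((N : ℝ) + 1) ≤ (A.card : ℝ) → Literature.MathematicalPhysics.KineticTheory.localGibbsLaw σ (fun _ => 1) (fun _ => 0) (fun _ => θ) N Φ {y : Literature.Analysis.FluidPDE.Config (N + 1) (Fin 3) (UnitAddTorus (Fin 3)) | let G := Literature.Analysis.FluidPDE.Torus.geometry (Fin 3); let ε : ℝ := Literature.MathematicalPhysics.KineticTheory.hsDiameter σ N; let pre := fun (k : ℕ) => (let zk := Literature.Analysis.FluidPDE.Alexander.stateAfter G ε y k; Literature.Analysis.FluidPDE.freeFlight G (Literature.Analysis.FluidPDE.Alexander.freeExitTime G ε zk).toReal zk); let pairsAt := fun (k : ℕ) => Literature.Analysis.FluidPDE.Alexander.incomingPairs G ε (pre k); let step := fun (W' : Fin (N + 1) → EuclideanSpace ℝ (Fin 3)) (k : ℕ) => @dite (Fin (N + 1) → EuclideanSpace ℝ (Fin 3)) (pairsAt k).Nonempty (Classical.propDecidable _) (fun h => fun i => (Literature.Analysis.FluidPDE.collidePair G h.some.1 h.some.2 (fun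 j => ((pre k j).1, W' j)) i).2) (fun _ => W'); let transferN := fun (n : ℕ) (W : Fin (N + 1) → EuclideanSpace ℝ (Fin 3)) => (List.range n).foldl step W; let colls := fun (Δ' : ℝ) => Literature.Analysis.FluidPDE.Alexander.collisionCount G ε y Δ'; let blockCol := fun (n : ℕ) (i k : Fin (N + 1)) (a : Fin 3) => transferN n (Pi.single k (EuclideanSpace.single a (1 : ℝ))) i; let blockMass := fun (n : ℕ) (i k : Fin (N + 1)) => ∑ a : Fin 3, ‖blockCol n i k a‖ ^ 2; let normalAt := fun (k : ℕ) => @dite (EuclideanSpace ℝ (Fin 3)) (pairsAt k).Nonempty (Classical.propDecidable _) (fun h => G.sepVec (pre k h.some.1).1 (pre k h.some.2).1) (fun _ => 0); let unitNormal := fun (k : ℕ) => ‖normalAt k‖⁻¹ • normalAt k; let Touches := fun (k : ℕ) (i : Fin (N + 1)) => ∃ h : (pairsAt k).Nonempty, h.some.1 = i ∨ h.some.2 = i; let slotSt := fun (Δ' : ℝ) (S r : ℕ) => colls ((r : ℝ) * Δ' / (S : ℝ)); let HasCollIn := fun (Δ' : ℝ) (S r : ℕ) (i : Fin (N + 1))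 => ∃ k, slotSt Δ' S r ≤ k ∧ k < slotSt Δ' S (r + 1) ∧ Touches k i; let nearDir := fun (α' : ℝ) (u : Fin 3 → EuclideanSpace ℝ (Fin 3)) => {ω : EuclideanSpace ℝ (Fin 3) | ∃ a : Fin 3, (∀ b, ‖u b‖ ≤ ‖u a‖) ∧ (⟪ω, ‖u a‖⁻¹ • u a⟫_ℝ ^ 2 < α' ^ 2 ∨ 1 - α' ^ 2 < ⟪ω, ‖u a‖⁻¹ • u a⟫_ℝ ^ 2)}; let nearScore := fun (Δ' : ℝ) (S r : ℕ) (α' : ℝ) (i : Fin (N + 1)) => @dite ℝ (HasCollIn Δ' S r i) (Classical.propDecidable _) (fun h => ∑ k : Fin (N + 1), blockMass (@Nat.find (fun n => slotSt Δ' S r ≤ n ∧ n < slotSt Δ' S (r + 1) ∧ Touches n i) (fun a => @instDecidableAnd (slotSt Δ' S r ≤ a) (a < slotSt Δ' S (r + 1) ∧ Touches a i) (Nat.decLe _ _) (@instDecidableAnd _ _ (Nat.decLt _ _) (Classical.propDecidable _))) h) i k / 3 * (@ite ℝ (unitNormal (@Nat.find (fun n => slotSt Δ' S r ≤ n ∧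 n < slotSt Δ' S (r + 1) ∧ Touches n i) (fun a => @instDecidableAnd (slotSt Δ' S r ≤ a) (a < slotSt Δ' S (r + 1) ∧ Touches a i) (Nat.decLe _ _) (@instDecidableAnd _ _ (Nat.decLt _ _) (Classical.propDecidable _))) h) ∈ nearDir α' (blockCol (@Nat.find (fun n => slotSt Δ' S r ≤ n ∧ n < slotSt Δ' S (r + 1) ∧ Touches n i) (fun a => @instDecidableAnd (slotSt Δ' S r ≤ a) (a < slotSt Δ' S (r + 1) ∧ Touches a i) (Nat.decLe _ _) (@instDecidableAnd _ _ (Nat.decLt _ _) (Classical.propDecidable _))) h) i k)) (Classical.propDecidable _) 1 0)) (fun _ => 0); ∀ i ∈ A, δ ≤ nearScore (Δ N) S r α i} ≤ ENNReal.ofReal ((K * α / δ) ^ ((A.card : ℝ) / 2))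

/-- child TracerRemergeBounded (scratch copy, text-identical with the route item to be filed). -/
def TracerRemergeBounded : Prop :=
  ∀ (a₀ θ₀ : UnitAddTorus (Fin 3) → ℝ) (u₀ : UnitAddTorus (Fin 3) → EuclideanSpace ℝ (Fin 3)), Continuous a₀ → Continuous θ₀ → Continuous u₀ → (∀ x, 0 < a₀ x) → (∀ x, 0 < θ₀ x) → ∃ σ₀ : ℝ, 0 < σ₀ ∧ ∀ σ : ℝ, 0 < σ → σ < σ₀ → ∀ Φ : (N : ℕ) → Literature.Analysis.FluidPDE.HardSphereFlow (Literature.Analysis.FluidPDE.Torus.geometry (Fin 3)) (Literature.MathematicalPhysics.KineticTheory.hsDiameter σ N) (N + 1), ∀ Δ : ℕ → ℝ, (∀ N, 0 < Δ N) → Tendsto Δ atTop (𝓝 0) → Tendsto (fun N : ℕ => Δ N * ((N + 1 : ℕ) : ℝ) ^ ((1 : ℝ) / 3)) atTop atTop → ∀ t : ℝ, 0 < t → ∃ M : ℝ, 0 ≤ M ∧ ∀ᶠ N : ℕ in atTop, ∫⁻ z, ENNReal.ofReal (let y := (Φ N).flow (t - Δ N) z; let G := Literature.Analysis.FluidPDE.Torus.geometry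 (Fin 3); let ε : ℝ := Literature.MathematicalPhysics.KineticTheory.hsDiameter σ N; let pre := fun (k : ℕ) => (let zk := Literature.Analysis.FluidPDE.Alexander.stateAfter G ε y k; Literature.Analysis.FluidPDE.freeFlight G (Literature.Analysis.FluidPDE.Alexander.freeExitTime G ε zk).toReal zk); let pairsAt := fun (k : ℕ) => Literature.Analysis.FluidPDE.Alexander.incomingPairs G ε (pre k); let step := fun (W' : Fin (N + 1) → EuclideanSpace ℝ (Fin 3)) (k : ℕ) => @dite (Fin (N + 1) → EuclideanSpace ℝ (Fin 3)) (pairsAt k).Nonempty (Classical.propDecidable _) (fun h => fun i => (Literature.Analysis.FluidPDE.collidePair G h.some.1 h.some.2 (fun j => ((pre k j).1, W' j)) i).2) (fun _ => W'); let transferN := fun (n : ℕ) (W : Fin (N + 1) → EuclideanSpace ℝ (Fin 3)) => (List.range n).foldl step W; let colls := fun (Δ' : ℝ) => Literature.Analysis.FluidPDE.Alexander.collisionCount G ε y Δ'; let blockCol := fun (n : ℕ) (i k : Fin (N + 1)) (a : Fin 3) => transferN n (Pi.single k (EuclideanSpace.single a (1 : ℝ))) i; let blockMass := fun (n : ℕ)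 (i k : Fin (N + 1)) => ∑ a : Fin 3, ‖blockCol n i k a‖ ^ 2; let blockShare := fun (n : ℕ) (i k : Fin (N + 1)) (ω : EuclideanSpace ℝ (Fin 3)) => ∑ a : Fin 3, ⟪ω, blockCol n i k a⟫_ℝ ^ 2; let normalAt := fun (k : ℕ) => @dite (EuclideanSpace ℝ (Fin 3)) (pairsAt k).Nonempty (Classical.propDecidable _) (fun h => G.sepVec (pre k h.some.1).1 (pre k h.some.2).1) (fun _ => 0); let unitNormal := fun (k : ℕ) => ‖normalAt k‖⁻¹ • normalAt k; let shareFrac := fun (n : ℕ) (i k : Fin (N + 1)) (ω : EuclideanSpace ℝ (Fin 3)) => blockShare n i k ω / blockMass n i k; let mergeAt := fun (src : Fin (N + 1)) (k : ℕ) => @dite ℝ (pairsAt k).Nonempty (Classical.propDecidable _) (fun h => 2 * (blockMass k h.some.1 src / 3) * (blockMass k h.some.2 src / 3) * (shareFrac k h.some.1 src (unitNormal k) * (1 - shareFrac k h.some.2 src (unitNormal k)) + shareFrac k h.some.2 src (unitNormal k) * (1 - shareFrac k h.some.1 src (unitNormal k)))) (fun _ => 0); let totalRemFr := fun (Δ'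 : ℝ) => ((N + 1 : ℕ) : ℝ)⁻¹ * ∑ src : Fin (N + 1), ∑ c ∈ Finset.range (colls Δ'), mergeAt src c; totalRemFr (Δ N)) ∂(Literature.MathematicalPhysics.KineticTheory.localGibbsLaw σ a₀ u₀ θ₀ N (Φ N)) ≤ ENNReal.ofReal M

/-- child TracerDelayedRemergeRare (scratch copy, text-identical with the route item to be filed). -/
def TracerDelayedRemergeRare : Prop :=
  ∀ (a₀ θ₀ : UnitAddTorus (Fin 3) → ℝ) (u₀ : UnitAddTorus (Fin 3) → EuclideanSpace ℝ (Fin 3)), Continuous a₀ → Continuous θ₀ → Continuous u₀ → (∀ x, 0 < a₀ x) → (∀ x, 0 < θ₀ x) → ∃ σ₀ : ℝ, 0 < σ₀ ∧ ∀ σ : ℝ, 0 < σ → σ < σ₀ → ∀ Φ : (N : ℕ) → Literature.Analysis.FluidPDE.HardSphereFlow (Literature.Analysis.FluidPDE.Torus.geometry (Fin 3)) (Literature.MathematicalPhysics.KineticTheory.hsDiameter σ N) (N + 1), ∀ Δ : ℕ → ℝ, (∀ N, 0 < Δ N) → Tendsto Δ atTop (𝓝 0) → Tendsto (fun N : ℕ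 => Δ N * ((N + 1 : ℕ) : ℝ) ^ ((1 : ℝ) / 3)) atTop atTop → ∀ t : ℝ, 0 < t → ∀ S : ℕ, 2 ≤ S → ∀ ε' : ℝ, 0 < ε' → ∀ᶠ N : ℕ in atTop, ∫⁻ z, ENNReal.ofReal (let y := (Φ N).flow (t - Δ N) z; let G := Literature.Analysis.FluidPDE.Torus.geometry (Fin 3); let ε : ℝ := Literature.MathematicalPhysics.KineticTheory.hsDiameter σ N; let pre := fun (k : ℕ) => (let zk := Literature.Analysis.FluidPDE.Alexander.stateAfter G ε y k; Literature.Analysis.FluidPDE.freeFlight G (Literature.Analysis.FluidPDE.Alexander.freeExitTime G ε zk).toReal zk); let pairsAt := fun (k : ℕ) => Literature.Analysis.FluidPDE.Alexander.incomingPairs G ε (pre k); let step := fun (W' : Fin (N + 1) → EuclideanSpace ℝ (Fin 3)) (k : ℕ) => @dite (Fin (N + 1) → EuclideanSpace ℝ (Fin 3)) (pairsAt k).Nonempty (Classical.propDecidable _) (fun h => fun i => (Literature.Analysis.FluidPDE.collidePair G h.some.1 h.some.2 (fun j => ((pre k j).1, W' j)) i).2) (fun _ => W'); let transferN := fun (n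 : ℕ) (W : Fin (N + 1) → EuclideanSpace ℝ (Fin 3)) => (List.range n).foldl step W; let colls := fun (Δ' : ℝ) => Literature.Analysis.FluidPDE.Alexander.collisionCount G ε y Δ'; let blockCol := fun (n : ℕ) (i k : Fin (N + 1)) (a : Fin 3) => transferN n (Pi.single k (EuclideanSpace.single a (1 : ℝ))) i; let blockMass := fun (n : ℕ) (i k : Fin (N + 1)) => ∑ a : Fin 3, ‖blockCol n i k a‖ ^ 2; let blockShare := fun (n : ℕ) (i k : Fin (N + 1)) (ω : EuclideanSpace ℝ (Fin 3)) => ∑ a : Fin 3, ⟪ω, blockCol n i k a⟫_ℝ ^ 2; let normalAt := fun (k : ℕ) => @dite (EuclideanSpace ℝ (Fin 3)) (pairsAt k).Nonempty (Classical.propDecidable _) (fun h => G.sepVec (pre k h.some.1).1 (pre k h.some.2).1) (fun _ => 0); let unitNormal := fun (k : ℕ) => ‖normalAt k‖⁻¹ • normalAt k; let slotSt := fun (Δ' : ℝ) (S r : ℕ) => colls ((r : ℝ) * Δ' / (S : ℝ)); let shareFrac := fun (n : ℕ) (i k : Fin (N + 1)) (ω : EuclideanSpace ℝ (Fin 3))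 => blockShare n i k ω / blockMass n i k; let hopK := fun (src : Fin (N + 1)) (n : ℕ) (i' i : Fin (N + 1)) => @dite ℝ (pairsAt n).Nonempty (Classical.propDecidable _) (fun h => if i' = h.some.1 then (if i = h.some.1 then 1 - shareFrac n h.some.1 src (unitNormal n) else if i = h.some.2 then shareFrac n h.some.1 src (unitNormal n) else 0) else if i' = h.some.2 then (if i = h.some.2 then 1 - shareFrac n h.some.2 src (unitNormal n) else if i = h.some.1 then shareFrac n h.some.2 src (unitNormal n) else 0) else if i = i' then 1 else 0) (fun _ => if i = i' then 1 else 0); let apartFr := fun (src : Fin (N + 1)) (Δ' : ℝ) (S r : ℕ) (t : ℕ) => Nat.rec (motive := fun _ => Fin (N + 1) → Fin (N + 1) → ℝ) (fun i j => if i = j then 0 else blockMass (slotSt Δ' S r) i src / 3 * (blockMass (slotSt Δ' S r) j src / 3)) (fun t' ih => fun i j => if i = j then 0 else ∑ i' : Fin (N + 1), ∑ j' : Fin (N + 1), ih i' j' * (hopK src (slotSt Δ' S r + t') i' i * hopK src (slotSt Δ' S r + t') j' j)) t; let delRemAt := fun (src : Fin (N + 1)) (Δ' : ℝ) (S r t :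 ℕ) => (let len : ℕ := slotSt Δ' S r - slotSt Δ' S (r - 1); let n : ℕ := slotSt Δ' S (r - 1) + (len + t); ∑ i : Fin (N + 1), ∑ i' : Fin (N + 1), ∑ j' : Fin (N + 1), apartFr src Δ' S (r - 1) (len + t) i' j' * (hopK src n i' i * hopK src n j' i)); let delRemFr := fun (Δ' : ℝ) (S : ℕ) => ((N + 1 : ℕ) : ℝ)⁻¹ * ∑ src : Fin (N + 1), ∑ r ∈ Finset.Ico 1 S, ∑ t ∈ Finset.range (slotSt Δ' S (r + 1) - slotSt Δ' S r), delRemAt src Δ' S r t; delRemFr (Δ N) S) ∂(Literature.MathematicalPhysics.KineticTheory.localGibbsLaw σ a₀ u₀ θ₀ N (Φ N)) ≤ ENNReal.ofReal ε'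

end Summit.AtomisticToContinuum.HydrodynamicLimit.Theses.CollisionIsometryCLT.SplitScratch

namespace Summit.AtomisticToContinuum.HydrodynamicLimit.Theorems.DiffuseBackwardInfluenceShare

open scoped BigOperators Topology ENNReal InnerProductSpace Classical
open Filter Set MeasureTheory
open Literature.Analysis.FluidPDE (Config HardSphereFlow collidePair)
open Literature.MathematicalPhysics.KineticTheory (localGibbsLaw hsDiameter)
open Summit.AtomisticToContinuum.HydrodynamicLimit.Theorems.DiffuseBackwardInfluenceNeg
open Summit.AtomisticToContinuum.HydrodynamicLimit.Theses.CollisionIsometryCLT.SplitScratch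

noncomputable section

namespace Split

/-! ### R-layer for the delayed re-merge functionals: `Nat.rec` copies of `apartFrom` & co. -/

variable (σ : ℝ) (N : ℕ)

/-- `apartFrom` written with the bare recursor (the form a one-line route item can spell). -/
def apartFromR (y : Cfg N) (src : Fin (N + 1)) (Δ : ℝ) (S r t : ℕ) : Fin (N + 1) → Fin (N + 1) → ℝ :=
  Nat.rec (motive := fun _ => Fin (N + 1) → Fin (N + 1) → ℝ)
    (fun i j => if i = j then 0 else
      blockMass σ N y (slotStart σ N y Δ S r) i src / 3 * (blockMass σ N y (slotStart σ N y Δ S r) j src / 3))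
    (fun t ih => fun i j => if i = j then 0 else
      ∑ i' : Fin (N + 1), ∑ j' : Fin (N + 1), ih i' j' *
        (hopKernel σ N y src (slotStart σ N y Δ S r + t) i' i * hopKernel σ N y src (slotStart σ N y Δ S r + t) j' j)) t

/-- `delayedRemAt` over `apartFromR`. -/
def delayedRemAtR (y : Cfg N) (src : Fin (N + 1)) (Δ : ℝ) (S r t : ℕ) : ℝ :=
  let len : ℕ := slotStart σ N y Δ S r - slotStart σ N y Δ S (r - 1)
  let n : ℕ := slotStart σ N y Δ S (r - 1) + (len + t)
  ∑ i : Fin (N + 1), ∑ i' : Fin (N + 1), ∑ j' : Fin (N + 1), apartFromR σ N y src Δ S (r - 1) (len + t) i' j' *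
    (hopKernel σ N y src n i' i * hopKernel σ N y src n j' i)

/-- `delayedRemFr` over `apartFromR`. -/
def delayedRemFrR (y : Cfg N) (Δ : ℝ) (S : ℕ) : ℝ :=
  ((N + 1 : ℕ) : ℝ)⁻¹ * ∑ src : Fin (N + 1), ∑ r ∈ Finset.Ico 1 S,
    ∑ t ∈ Finset.range (slotStart σ N y Δ S (r + 1) - slotStart σ N y Δ S r), delayedRemAtR σ N y src Δ S r t

variable {σ N}

theorem apartFromR_eq (y : Cfg N) (src : Fin (N + 1)) (Δ : ℝ) (S r : ℕ) :
    ∀ t, apartFromR σ N y src Δ S r t = apartFrom σ N y src Δ S r t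
  | 0 => rfl
  | t + 1 => by
      have ih := apartFromR_eq y src Δ S r t
      show (fun i j => if i = j then (0 : ℝ) else
        ∑ i' : Fin (N + 1), ∑ j' : Fin (N + 1), apartFromR σ N y src Δ S r t i' j' *
          (hopKernel σ N y src (slotStart σ N y Δ S r + t) i' i * hopKernel σ N y src (slotStart σ N y Δ S r + t) j' j)) = _
      rw [ih]
      rfl

theorem delayedRemFrR_eq (y : Cfg N) (Δ : ℝ) (S : ℕ) : delayedRemFrR σ N y Δ S = delayedRemFr σ N y Δ S := by
  simp only [delayedRemFrR, delayedRemFr, delayedRemAtR, delayedRemAt, apartFromR_eq]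

end Split

/-! ### The three bridges -/

set_option maxHeartbeats 1000000 in
theorem tracerNearSetLD_iff :
    TracerNearSetLD ↔ (∃ σ₀ : ℝ, 0 < σ₀ ∧ ∀ σ : ℝ, 0 < σ → σ < σ₀ → ∀ θ : ℝ, 0 < θ → ShareLD.NearSetLD σ θ) :=
  Iff.rfl

set_option maxHeartbeats 1000000 in
theorem tracerRemergeBounded_iff : TracerRemergeBounded ↔ PairPath.RemergeBounded :=
  Iff.rfl

set_option maxHeartbeats 1000000 in
theorem tracerDelayedRemergeRare_iff : TracerDelayedRemergeRare ↔ DelayedRemergeRare := by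
  -- the inline child is DEFINITIONALLY the statement over the `Nat.rec` copy `Split.delayedRemFrR` …
  have h : TracerDelayedRemergeRare ↔
      (∀ (a₀ θ₀ : T3 → ℝ) (u₀ : T3 → V3), Continuous a₀ → Continuous θ₀ → Continuous u₀ →
        (∀ x, 0 < a₀ x) → (∀ x, 0 < θ₀ x) → ∃ σ₀ : ℝ, 0 < σ₀ ∧ ∀ σ : ℝ, 0 < σ → σ < σ₀ →
          ∀ Φ : (N : ℕ) → Flow σ N,
            ∀ Δ : ℕ → ℝ, (∀ N, 0 < Δ N) → Tendsto Δ atTop (𝓝 0) →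
              Tendsto (fun N : ℕ => Δ N * ((N + 1 : ℕ) : ℝ) ^ ((1 : ℝ) / 3)) atTop atTop →
              ∀ t : ℝ, 0 < t → ∀ S : ℕ, 2 ≤ S → ∀ ε : ℝ, 0 < ε →
                ∀ᶠ N : ℕ in atTop,
                  ∫⁻ z, ENNReal.ofReal (Split.delayedRemFrR σ N ((Φ N).flow (t - Δ N) z) (Δ N) S)
                      ∂(localGibbsLaw σ a₀ u₀ θ₀ N (Φ N)) ≤ ENNReal.ofReal ε) :=
    Iff.rfl
  -- … which is the Theorems decl after rewriting `delayedRemFrR = delayedRemFr`.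
  rw [h]
  simp only [DelayedRemergeRare, DelayedRemergeRareAt, Split.delayedRemFrR_eq]

/-! ### The split glue: the crux from its three promoted inputs (composition of the LANDED v8 stubs) -/

/-- **Glue of the route-level split** `DiffuseBackwardInfluence ⇐ TracerNearSetLD ∧ TracerRemergeBounded ∧ TracerDelayedRemergeRare`:
the three self-contained children are, by the bridges above, the v8 conjecture-level inputs `ShareLD.NearSetLD` (∃σ₀ ∀σ<σ₀ ∀θ>0),
`PairPath.RemergeBounded`, `DelayedRemergeRare`; the landed stubs `stub_pairPathBoundT` (p144187), `stub_delayedRemMeasurable` (p140290)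
and the composition `stub_cruxCompositionT` (p140696) give the crux's conclusion, and the crux's `let M; let ipr` are
`DiffuseBackwardInfluenceNeg.transfer/ipr` definitionally (as in the registered skeleton v8's `DiffuseBackwardInfluence_of`). -/
theorem DiffuseBackwardInfluence_of_subs (stub_pairPathBoundT : ∀ σ : ℝ, RowBudgetN σ → PairPathBoundT σ) :
    TracerNearSetLD → TracerRemergeBounded → TracerDelayedRemergeRare →
      Summit.AtomisticToContinuum.HydrodynamicLimit.Theses.CollisionIsometryCLT.DiffuseBackwardInfluence := by
  intro hN hR hD
  have hNear : ∃ σ₀ : ℝ, 0 < σ₀ ∧ ∀ σ : ℝ, 0 < σ → σ < σ₀ → ∀ θ : ℝ, 0 < θ → ShareLD.NearSetLD σ θ :=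
    tracerNearSetLD_iff.1 hN
  have hRem : PairPath.RemergeBounded := tracerRemergeBounded_iff.1 hR
  have hDel : DelayedRemergeRare := tracerDelayedRemergeRare_iff.1 hD
  intro a₀ θ₀ u₀ ha hθ hu ha0 hθ0
  obtain ⟨σ₀, hσ₀, H⟩ := stub_cruxCompositionT stub_pairPathBoundT stub_delayedRemMeasurable hNear hRem hDel
    a₀ θ₀ u₀ ha hθ hu ha0 hθ0
  refine ⟨σ₀, hσ₀, ?_⟩
  intro σ hσ hσlt M ipr' Φ Δ hΔ hΔ0 hΔ1 t ht
  exact H σ hσ hσlt Φ Δ hΔ hΔ0 hΔ1 t ht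

end

end Summit.AtomisticToContinuum.HydrodynamicLimit.Theorems.DiffuseBackwardInfluenceShare
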